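import Summits.BirchSwinnertonDyer.Rank1Residual.Supersingular.X6KimTamDefectShapeLValues
import Summits.BirchSwinnertonDyer.Rank1Residual.Supersingular.KuriharaTwistRecordLevelKPrimeLevel
import Literature.NumberTheory.EllipticCurves.Rank1Residual.Typed.CasselsLowerBound
import Summits.BirchSwinnertonDyer.Rank1Residual.Supersingular.KuriharaLevelOnePrimePower
import Summits.BirchSwinnertonDyer.Rank1Residual.Additive.PlusSymbolIntegrality
import Literature.NumberTheory.EllipticCurves.AtkinLehnerFrickeLevelProofs
import Literature.NumberTheory.EllipticCurves.PAdicLFunctionNonvanishingProofs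
import HarnessLib

/-!
# N4 TAM-DEFECT, SINGLE-PRIME ROUTE: `BSD(E,p)` on X6 ∧ `r_an = 0` ∧ `p ∣ ∏c_ℓ` from ONE Kurihara number at ONE Kolyvagin
# prime of depth `k ≤ ord_p ∏c_ℓ + 2` (Kim 2026 Thm. 1.8 (6)), Cassels–Tate SQUARENESS of `#Ш`, and Perrin-Riou's upper bound
# (Prop. 4.8) — the shapes (class-free lower half, class form, standard-currency form, literal prime-level record form)

Cell `b2b-bsdres`, supersingular family, prover A = unit `b2b-bsdres-x10b` (gen 14; X6 = A's class, N4 class lead).  Topic file;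
namespace `Summit.BirchSwinnertonDyer.Rank1Residual.Supersingular`.  THEOREMS ONLY (compositions of tree theorems by name); no named
fact minted, no definition, nothing asserted about any curve, nothing booked; X6 stays CONSTRUCTION-SHAPED (RESIDUAL-MAP §I N4).

HONEST FRAMING (run/shared/lean/b2b/bsd-rank1-residual/, verbatim in every file): the goal of the
cell is to DELETE the COMBINATION-SHAPED residual classes of the Birch–Swinnerton-Dyer formula for
ALL analytic-rank `≤ 1` elliptic curves over `ℚ` — "full BSD formula for every rank `≤ 1` curve in
class `C`" assembled STRICTLY from published theorems — so that the rank-`≤ 1` remainder becomes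
exactly the CONSTRUCTION-SHAPED classes, which are TYPED (missing-input `Prop`s), NOT attempted.
This is not "finishing BSD".

## Why this file exists (the one-line idea)

The N4 per-pair residue after gen 13 is EXACTLY four TAM-DEFECT cells (22678e1@5 `t = 2`; 130798a1@7, 399190l1@7, 492414f1@5
`t = 1`; `t = ord_p ∏c_ℓ`, `#Ш_an = p²`).  The depth-`(t+1)` route of `X6KimTamDefectShape.lean` (gen 13; Kim 2026 Thm. 1.8 (6):
`δ̃_n^{(k)} ≠ 0` at `n ∈ 𝒩_k` ⟹ `ord_p(L(E,1)/Ω) ≤ ord_p #Ш + (k − 1)`, so `k ≤ t + 1` gives the LOWER half outright) needs a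
TWO-prime level `ℓ₁ℓ₂ ∈ 𝒩_{t+1}` there (Kim §1.5.1: `∂^{(1)}(δ̃) = t + 1` when `Ш[p^∞] ≅ (ℤ/p)²`, so every single-prime Kurihara
number of depth `≤ t + 1` vanishes), and the cheapest such levels cost `≥ 2.7·10¹¹` series terms (`≈ 1 500` core-h per cell).
ONE MORE UNIT OF DEPTH trades the second prime for Cassels–Tate: at a SINGLE prime `ℓ ∈ 𝒫_{t+2}` Kim's inequality with `k = t + 2`
gives only `ord_p #Ш ≥ ord_p #Ш_an − 1`; but `#Ш` is a SQUARE (Cassels 1962 / Tate 1963, the tree's named fact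
`exists_casselsTate_pairing` = bsd.S18, through `Typed.missingLowerBoundAt_of_casselsTate_of_pow_dvd` — the SAME step the cell's
`p = 3` descent rows `DescentLowerBound.lean` take) and `ord_p #Ш_an` is EVEN (`= 2` on all four cells; the per-pair datum `hv`, as on
the DESC3 rows), so `ord_p #Ш ≥ ord_p #Ш_an`: the LOWER half.  With Perrin-Riou 2003 Prop. 4.8 (the UPPER half, PUBLISHED, automatic
image hypothesis on X6) this is `BSD(E,p)`.  Cost: one prime `ℓ ≈ 3·10⁵ … 2·10⁶` (x10b g14 scan kit j151259), i.e. `2·10⁹ … 7·10⁹`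
series terms per cell — two orders of magnitude below the two-prime route.  The point count at such `ℓ` is certified in the kernel
by the ORDER CERTIFICATE of `PointCountOrderCertificate.lean` (this gen), not by an `ℓ`-term sum.

## What this file proves

* §1 `missingLowerBoundAt_rankZero_of_kimLower_of_casselsTate` (class-free; rank `0`, `p ≥ 5`, `ρ̄` onto, ANY reduction at `p`):
  Kim's lower reading at a cyclic level `n ∈ 𝒩_k` with `k ≤ ord_p ∏c_ℓ + 2` + `#Ш_an = q`, `ord_p q = 2s` + Cassels–Tate ⟹
  `Typed.MissingLowerBoundAt W p`; and `bsdp_rankZero_of_kimLower_of_casselsTate_of_missingUpperBoundAt` (+ any upper half ⟹ `BSDp`).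
* §2 `X6RankZero.bsdp_of_kimLower_of_casselsTate_of_prop48` — class form on X6 (upper half Perrin-Riou Prop. 4.8, surj automatic).
* §3 `X6RankZero.bsdp_of_kimLower_of_casselsTate_of_prop48_of_certifiedK_of_LValueBall` — STANDARD CURRENCY: the datum `hδ`
  replaced by a LANDED `CertifiedK` row + `validHasseK` rounding certificate + the engine's `L`-value enclosure `hballL`
  (`CertifiedK.kuriharaNumber_ne_zero_of_LValueBall`, gen 13).
* §4 `X6RankZero.bsdp_of_kimLower_of_casselsTate_of_prop48_of_ainvs_primeLevel_of_LValueBall` — the literal-equation RECORD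
  SHAPE at a PRIME level `ℓ = r.n ∈ 𝒫_{r.k}`: minimality instance, class X6 read off the model, the Kolyvagin prime from the count
  `countPoints … ℓ = n_ℓ` (supplied by `countPoints_eq_of_orderCert` at large `ℓ`), ONE cyclicity bound (ladder), `A = a_ℓ − 2`;
  REMAINING HYPOTHESES = EXACTLY `hKimL` (Kim 2026 Thm 1.8 (6)), `hCT` (Cassels–Tate), `h48` (Perrin-Riou Prop 4.8) — PUBLISHED —,
  `hGZK`, `hmod`; the data binders `r_an = 0`, `r.k ≤ ord_p ∏c_ℓ + 2` and `ord_p #Ш_an = 2s` (Cremona), `D`/`p ∤ c_D`/period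
  transfer; a `ψ` surjective at `ℓ`; `hballL`.

Per pair; NOT a class theorem; nothing booked.  The records built on §4 are `X6KimTamDefectSquareRecords*.lean` (this gen).

References: C.-H. Kim, AJM 148 (2026) Thm. 1.8 (6), §1.2.2, §1.4.3, §1.5.1–1.5.3 [Kim2022StructureSelmer]; J. W. S. Cassels,
J. reine angew. Math. 211 (1962) / J. Tate, Sém. Bourbaki 306 (1966) via Silverman *AEC* X.4.14 [SilvermanAEC2009]; B. Perrin-Riou,
Exp. Math. 12 (2003) Prop. 4.8 [PerrinRiou2003]; K. Kato, Astérisque 295 (2004) (12.5.2) [Kato2004Asterisque]; J.-P. Serre, Invent. 15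
(1972) Prop. 21 [Serre1972]; R. L. Miller, LMS JCM 14 (2011) Def. 1.1 [Miller2011LMS]; tree files `X4/KuriharaLowerHalf.lean`,
`Typed/CasselsLowerBound.lean`, `X6KimTamDefectShape(LValues).lean`, `KuriharaTwistRecordLevelKPrimeLevel.lean`, `PointCountOrderCertificate.lean`.
-/

set_option autoImplicit false

noncomputable section

open scoped Classical MatrixGroups ModularForm

open CongruenceSubgroup WeierstrassCurve Literature.NumberTheory.EllipticCurves
  Literature.NumberTheory.EllipticCurves.ModularForms
  Literature.NumberTheory.EllipticCurves.Rank1Residual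
  Literature.NumberTheory.EllipticCurves.Rank1Residual.Typed
  Literature.NumberTheory.EllipticCurves.Rank1Residual.X11RankOneCertificates
  Summit.BirchSwinnertonDyer.BirchSwinnertonDyer.Rank1Residual.IntModel
  Summit.BirchSwinnertonDyer.BirchSwinnertonDyer.Rank1Residual.X11RankOne
  Summit.BirchSwinnertonDyer.Rank1Residual.X11b
  Summit.BirchSwinnertonDyer.Rank1Residual.Additive
  Summit.BirchSwinnertonDyer.Rank1Residual.Supersingular.KuriharaTwist

namespace Summit.BirchSwinnertonDyer.Rank1Residual.Supersingular

/-! ### §1 Class-free: the LOWER half from a depth-`(≤ t + 2)` Kurihara number and Cassels–Tate -/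

/-- **LOWER half per pair from a Kurihara number of depth `k ≤ ord_p ∏c_ℓ + 2` AND Cassels–Tate squareness** (rank `0`,
`p ≥ 5`, ANY reduction at `p`, `ρ̄_{E,p}` onto; Kim 2026 Thm. 1.8 (6) beyond the unit case `hKim`; Cassels–Tate `hCT`; GZK
`hGZK`): Kim's reading of `δ̃_n^{(k)} ≠ 0` (`X4.padicValRat_shaAn_le_of_kimLower`) is `ord_p #Ш_an + t ≤ ord_p #Ш + (k − 1)`,
`t = ord_p ∏c_ℓ`; with `k − 1 ≤ t + 1` and the datum `ord_p #Ш_an = 2s` this is `p^{2s−1} ∣ #Ш`, and `#Ш` is a square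
(`missingLowerBoundAt_of_casselsTate_of_pow_dvd`), so `ord_p #Ш_an ≤ ord_p #Ш`.  Per pair; NOT a class theorem.
[cite: Kim2022StructureSelmer, Thm. 1.9 (6) (PDF p. 8) and §1.5.1–1.5.3 (PDF pp. 7–8)] [cite: SilvermanAEC2009, Thm. X.4.14]
[cite: Miller2011LMS, Def. 1.1] -/
theorem missingLowerBoundAt_rankZero_of_kimLower_of_casselsTate
    (W : WeierstrassCurve ℚ) [W.IsElliptic] [W.IsGloballyMinimal] (p : ℕ) [Fact p.Prime]
    (hKim : Kim2026.rankZero_le_padicValNat_sha_of_kuriharaNumber_ne_zero)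
    (hCT : exists_casselsTate_pairing (K := ℚ))
    (hGZK : rank_eq_analyticRank_of_analyticRank_le_one) (hp5 : 5 ≤ p)
    (hsurj : Surj W p) (hL : W.entireLFunction 1 ≠ 0)
    {N : ℕ} [NeZero N] (D : ModularParametrizationData W N) (hc : ¬ (p : ℤ) ∣ D.maninConstant)
    (hper : ∃ u : ℚ, ‖(u : ℚ_[p])‖ = 1 ∧ W.realPeriodRat = u * plusPeriod D.f)
    (k n : ℕ) [NeZero n] (hk : 1 ≤ k) (hkt : k ≤ padicValNat p W.tamagawaProduct + 2)
    (hn : Kato.IsKolyvaginProduct W p k n)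
    (hcyc : ∀ (ℓ : ℕ) [Fact ℓ.Prime], ℓ ∣ n →
      Nat.card {P : ((WeierstrassCurve.integralModelInt W).map
          (Int.castRingHom (ZMod ℓ))).toAffine.Point // p • P = 0} ≤ p)
    (ψ : (ℓ : ℕ) → (ZMod ℓ)ˣ →* Multiplicative (ZMod (p ^ k)))
    (hψ : ∀ ℓ ∈ n.primeFactors, Function.Surjective (ψ ℓ))
    (hδ : kuriharaNumber D.f (p ^ k) n ψ ≠ 0)
    {q : ℚ} (hq : shaAn W = (q : ℂ)) {s : ℕ} (hv : padicValRat p q = 2 * s) :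
    MissingLowerBoundAt W p := by
  obtain ⟨q', hq', hle⟩ := X4.padicValRat_shaAn_le_of_kimLower W p hKim hGZK hp5 hsurj hL D hc hper k n hk hn hcyc ψ hψ hδ
  have hqq : q' = q := by exact_mod_cast hq'.symm.trans hq
  rw [hqq] at hle
  have hr0 : W.analyticRank = 0 := analyticRank_eq_zero_of_entireLFunction_one_ne_zero W hL
  have hfin := (hGZK W (by rw [hr0]; exact zero_le_one)).2
  have hn0 : W.shaOrder ≠ 0 := (WeierstrassCurve.shaOrder_pos W hfin).ne'
  have hkt' : ((k - 1 : ℕ) : ℤ) ≤ (padicValNat p W.tamagawaProduct : ℤ) + 1 := by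
    have : k - 1 ≤ padicValNat p W.tamagawaProduct + 1 := by omega
    exact_mod_cast this
  have h2 : 2 * s ≤ padicValNat p W.shaOrder + 1 := by
    have : (2 * s : ℤ) ≤ (padicValNat p W.shaOrder : ℤ) + 1 := by rw [← hv]; linarith
    exact_mod_cast this
  have hdvd : p ^ (2 * s - 1) ∣ W.shaOrder := (padicValNat_dvd_iff_le hn0).2 (by omega)
  exact missingLowerBoundAt_of_casselsTate_of_pow_dvd W p hCT hfin hq (k := s) (le_of_eq hv) hdvd

/-- **`BSD(E,p)` per pair from a depth-`(≤ t + 2)` Kurihara certificate, Cassels–Tate, AND any upper half** (rank `0`, `p ≥ 5`,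
any reduction at `p`): the two halves make Miller's `BSD(E,p)` (`Typed.missingPPartAt_of_lower_of_upper`, `bsdp_of_missingPPartAt`).
[cite: Kim2022StructureSelmer, Thm. 1.9 (6) (PDF p. 8)] [cite: SilvermanAEC2009, Thm. X.4.14] [cite: Miller2011LMS, Def. 1.1] -/
theorem bsdp_rankZero_of_kimLower_of_casselsTate_of_missingUpperBoundAt
    (W : WeierstrassCurve ℚ) [W.IsElliptic] [W.IsGloballyMinimal] (p : ℕ) [Fact p.Prime]
    (hKim : Kim2026.rankZero_le_padicValNat_sha_of_kuriharaNumber_ne_zero)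
    (hCT : exists_casselsTate_pairing (K := ℚ))
    (hGZK : rank_eq_analyticRank_of_analyticRank_le_one) (hp5 : 5 ≤ p)
    (hsurj : Surj W p) (hL : W.entireLFunction 1 ≠ 0)
    {N : ℕ} [NeZero N] (D : ModularParametrizationData W N) (hc : ¬ (p : ℤ) ∣ D.maninConstant)
    (hper : ∃ u : ℚ, ‖(u : ℚ_[p])‖ = 1 ∧ W.realPeriodRat = u * plusPeriod D.f)
    (k n : ℕ) [NeZero n] (hk : 1 ≤ k) (hkt : k ≤ padicValNat p W.tamagawaProduct + 2)
    (hn : Kato.IsKolyvaginProduct W p k n)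
    (hcyc : ∀ (ℓ : ℕ) [Fact ℓ.Prime], ℓ ∣ n →
      Nat.card {P : ((WeierstrassCurve.integralModelInt W).map
          (Int.castRingHom (ZMod ℓ))).toAffine.Point // p • P = 0} ≤ p)
    (ψ : (ℓ : ℕ) → (ZMod ℓ)ˣ →* Multiplicative (ZMod (p ^ k)))
    (hψ : ∀ ℓ ∈ n.primeFactors, Function.Surjective (ψ ℓ))
    (hδ : kuriharaNumber D.f (p ^ k) n ψ ≠ 0)
    {q : ℚ} (hq : shaAn W = (q : ℂ)) {s : ℕ} (hv : padicValRat p q = 2 * s)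
    (hup : MissingUpperBoundAt W p) : BSDp W p :=
  bsdp_of_missingPPartAt W p hGZK
    (by rw [analyticRank_eq_zero_of_entireLFunction_one_ne_zero W hL]; exact zero_le_one)
    (missingPPartAt_of_lower_of_upper W p
      (missingLowerBoundAt_rankZero_of_kimLower_of_casselsTate W p hKim hCT hGZK hp5 hsurj hL D hc hper k n hk hkt hn
        hcyc ψ hψ hδ hq hv) hup)

/-! ### §2 Class form on X6 -/

/-- **N4 TAM-DEFECT, single-prime route, class form — `BSD(E,p)` on X6 ∧ `r_an = 0` ∧ `p ≥ 5` from ONE depth-`k` Kurihara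
number with `k ≤ ord_p ∏c_ℓ + 2`, Cassels–Tate, and the datum `ord_p #Ш_an = 2s`.**  Lower half: §1 (`hKimL`, `hCT`); upper half:
Perrin-Riou 2003 Prop. 4.8 (`h48`; `missingUpperBoundAt_of_prop48_of_surj`); surj(p) automatic on X6 (`ClassX6.surj`).  All three
named facts PUBLISHED.  Per pair; NOT a class theorem; nothing booked.
[cite: Kim2022StructureSelmer, Thm. 1.9 (6) (PDF p. 8) and §1.5.1–1.5.3 (PDF pp. 7–8)] [cite: SilvermanAEC2009, Thm. X.4.14]
[cite: PerrinRiou2003, Prop. 4.8 (p. 162)] [cite: Kato2004Asterisque, (12.5.2) in Thm. 12.5 (4) (p. 222)] [cite: Serre1972, §5.4 Prop. 21 i)]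
[cite: Miller2011LMS, Def. 1.1] -/
theorem X6RankZero.bsdp_of_kimLower_of_casselsTate_of_prop48 (W : WeierstrassCurve ℚ) [W.IsElliptic] [W.IsGloballyMinimal]
    (p : ℕ) [Fact p.Prime]
    (hKimL : Kim2026.rankZero_le_padicValNat_sha_of_kuriharaNumber_ne_zero)
    (hCT : exists_casselsTate_pairing (K := ℚ))
    (h48 : PerrinRiou2003.prop48_padicValRat_bsd_rank_zero_le)
    (hGZK : rank_eq_analyticRank_of_analyticRank_le_one) (hmod : hasEntireLFunction_rat)
    (hp5 : 5 ≤ p) (hX : ClassX6 W p) (hr : W.analyticRank = 0)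
    {N : ℕ} [NeZero N] (D : ModularParametrizationData W N) (hc : ¬ (p : ℤ) ∣ D.maninConstant)
    (hper : ∃ u : ℚ, ‖(u : ℚ_[p])‖ = 1 ∧ W.realPeriodRat = u * plusPeriod D.f)
    (k n : ℕ) [NeZero n] (hk : 1 ≤ k) (hkt : k ≤ padicValNat p W.tamagawaProduct + 2)
    (hn : Kato.IsKolyvaginProduct W p k n)
    (hcyc : ∀ (ℓ : ℕ) [Fact ℓ.Prime], ℓ ∣ n →
      Nat.card {P : ((WeierstrassCurve.integralModelInt W).map
          (Int.castRingHom (ZMod ℓ))).toAffine.Point // p • P = 0} ≤ p)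
    (ψ : (ℓ : ℕ) → (ZMod ℓ)ˣ →* Multiplicative (ZMod (p ^ k)))
    (hψ : ∀ ℓ ∈ n.primeFactors, Function.Surjective (ψ ℓ))
    (hδ : kuriharaNumber D.f (p ^ k) n ψ ≠ 0)
    {q : ℚ} (hq : shaAn W = (q : ℂ)) {s : ℕ} (hv : padicValRat p q = 2 * s) : BSDp W p := by
  have hsurj : Surj W p := ClassX6.surj W p (by omega) hX
  have hL : W.entireLFunction 1 ≠ 0 := (W.analyticRank_eq_zero_iff_holds (hmod W)).1 hr
  exact bsdp_rankZero_of_kimLower_of_casselsTate_of_missingUpperBoundAt W p hKimL hCT hGZK hp5 hsurj hL D hc hper k n hk hkt hn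
    hcyc ψ hψ hδ hq hv (PerrinRiou2003.missingUpperBoundAt_of_prop48_of_surj W p h48 hGZK hmod hp5 hX.1 hsurj hr)

/-! ### §3 Standard currency: a landed `CertifiedK` row + rounding certificate + `L`-value enclosure -/

/-- **N4 TAM-DEFECT, single-prime route, STANDARD CURRENCY — `BSD(E, r.p)` on X6 ∧ `r_an = 0` ∧ `r.p ≥ 5` from a LANDED depth-`r.k`
record (`CertifiedK`, `r.k ≤ ord_p ∏c_ℓ + 2`), its `validHasseK` rounding certificate, the engine's `L`-value enclosure, Cassels–Tate
and `ord_p #Ш_an = 2s`**: §2 with `hδ := CertifiedK.kuriharaNumber_ne_zero_of_LValueBall …`.  Named facts `hKimL`, `hCT`, `h48`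
PUBLISHED; `hGZK`, `hmod`.  Per pair; NOT a class theorem; nothing booked.
[cite: Kim2022StructureSelmer, Thm. 1.9 (6) (PDF p. 8), §1.4.3 (PDF p. 7) and §1.5.1–1.5.3 (PDF pp. 7–8)] [cite: SilvermanAEC2009, Thm. X.4.14]
[cite: PerrinRiou2003, Prop. 4.8 (p. 162)] [cite: MazurTateTeitelbaum1986Invent, §I.8 (8.6)] [cite: CremonaAlgorithms1997, §2.8 (2.8.8) (PDF p. 26)]
[cite: Miller2011LMS, Def. 1.1] -/
theorem X6RankZero.bsdp_of_kimLower_of_casselsTate_of_prop48_of_certifiedK_of_LValueBall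
    (W : WeierstrassCurve ℚ) [W.IsElliptic] [W.IsGloballyMinimal]
    (hKimL : Kim2026.rankZero_le_padicValNat_sha_of_kuriharaNumber_ne_zero)
    (hCT : exists_casselsTate_pairing (K := ℚ))
    (h48 : PerrinRiou2003.prop48_padicValRat_bsd_rank_zero_le)
    (hGZK : rank_eq_analyticRank_of_analyticRank_le_one) (hmod : hasEntireLFunction_rat)
    {rs : List TwistRecordK} (hrs : CertifiedK rs) {r : TwistRecordK} (hr' : r ∈ rs) [Fact r.p.Prime] [NeZero r.n]
    (hν : r.n.primeFactors.card = r.primes.length)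
    (hp5 : 5 ≤ r.p) (hX : ClassX6 W r.p) (hr : W.analyticRank = 0)
    {N : ℕ} [NeZero N] (D : ModularParametrizationData W N) (hc : ¬ (r.p : ℤ) ∣ D.maninConstant)
    (hper : ∃ u : ℚ, ‖(u : ℚ_[r.p])‖ = 1 ∧ W.realPeriodRat = u * plusPeriod D.f)
    (hk : 1 ≤ r.k) (hkt : r.k ≤ padicValNat r.p W.tamagawaProduct + 2)
    (hn : Kato.IsKolyvaginProduct W r.p r.k r.n)
    (hcyc : ∀ (ℓ : ℕ) [Fact ℓ.Prime], ℓ ∣ r.n →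
      Nat.card {P : ((WeierstrassCurve.integralModelInt W).map
          (Int.castRingHom (ZMod ℓ))).toAffine.Point // r.p • P = 0} ≤ r.p)
    {cs : List RoundingCert} (hcs : RoundingCertifiedHasseK r.k cs) {c : RoundingCert} (hcc : c ∈ cs)
    (hcp : c.p = r.p) (hcn : c.n = r.n) (hcden : c.den = r.den) (hcbins : c.bins = r.bins) (hD' : 0 < c.dstar)
    (ψ : (ℓ : ℕ) → (ZMod ℓ)ˣ →* Multiplicative (ZMod (r.p ^ r.k)))
    (hψ : ∀ ℓ ∈ r.n.primeFactors, Function.Surjective (ψ ℓ))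
    (hballL : ∀ (L : ZMod (r.p ^ r.k) → ℂ → ℂ), (∀ j, j ≠ 0 → Differentiable ℂ (L j)) →
      (∀ j, j ≠ 0 → ∀ s : ℂ, 2 < s.re → L j s = twistedLSeries D.f (binChar r.n ψ j)⁻¹ s) →
      ∀ k < r.p ^ r.k, ∃ mid rad : ℝ, rad ≤ (c.radNum : ℝ) / 10 ^ c.radExp ∧
        |mid - ((c.binsStar.getD k 0 : ℤ) : ℝ)| ≤ (c.marNum : ℝ) / 10 ^ c.marExp ∧
        |(c.dstar : ℝ) * ((r.components : ℝ) *
          (((∏ ℓ ∈ r.n.primeFactors, ((W.frobeniusTrace ℓ : ℂ) - 2)) * W.entireLFunction 1 +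
            ∑ j ∈ (Finset.univ : Finset (ZMod (r.p ^ r.k))).erase 0,
              ZMod.stdAddChar (-(j * (k : ZMod (r.p ^ r.k)))) *
                (gaussSum (binChar r.n ψ j) (ZMod.stdAddChar (N := r.n)) * L j 1)).re /
            ((r.p ^ r.k : ℕ) * plusPeriod D.f))) - mid| ≤ rad)
    {q : ℚ} (hq : shaAn W = (q : ℂ)) {s : ℕ} (hv : padicValRat r.p q = 2 * s) :
    BSDp W r.p :=
  X6RankZero.bsdp_of_kimLower_of_casselsTate_of_prop48 W r.p hKimL hCT h48 hGZK hmod hp5 hX hr D hc hper r.k r.n hk hkt hn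
    hcyc ψ hψ
    (CertifiedK.kuriharaNumber_ne_zero_of_LValueBall hrs hr' hν D.isNewformOf (by omega)
      (ClassX6.irr W r.p (by omega) hX) hX.1.1 hn hcs hcc hcp hcn hcden hcbins hD' ψ hψ hballL) hq hv

/-! ### §4 The literal-equation record shape at a PRIME level -/

/-- **N4 TAM-DEFECT RECORD SHAPE, SINGLE-PRIME ROUTE — `BSD(E, r.p)` on X6 ∧ `r_an = 0` ∧ `r.p ≥ 5` from the literal equation, ONE
Kolyvagin prime `ℓ = r.n ∈ 𝒫_{r.k}` (`r.k ≤ ord_p ∏c_ℓ + 2`) with cyclic `p`-part, a LANDED `CertifiedK` row `r` + `validHasseK r.k`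
rounding certificate `c` + the `L`-value enclosure `hballL`, Cassels–Tate, and the datum `ord_p #Ш_an = 2s`.**  Decidable inputs
(per record): minimality (instance; x11c bounded Kraus), `p ∤ Δ`, `countPoints … p = n_p` with `p ∣ p + 1 − n_p`, `gcd(Δ, c₄) = 1`
(class X6 via `classX6_of_intModel`); `ℓ ∤ Δ`, `ℓ ≡ 1 (mod p^k)`, the count `countPoints … ℓ = n_ℓ` (at large `ℓ` by the ORDER
CERTIFICATE `countPoints_eq_of_orderCert`) with `p^k ∣ n_ℓ`; ONE cyclicity bound `#Ẽ(𝔽_ℓ)[p] ≤ p` in the literal-model form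
(`card_torsion_le_of_ladder` on that count).  REMAINING HYPOTHESES = EXACTLY `hKimL`, `hCT`, `h48` (PUBLISHED), `hGZK`, `hmod`; the
data binders `r_an = 0`, `r.k ≤ ord_p ∏c_ℓ + 2` and `#Ш_an = q`, `ord_p q = 2s` (Cremona), `D` with `p ∤ c_D`, the period transfer;
`ψ` surjective at `ℓ`; `hballL` (with `A = a_ℓ − 2` explicit).  Per pair; NOT a class theorem; nothing booked.
[cite: Kim2022StructureSelmer, Thm. 1.9 (6) (PDF p. 8), §1.2.2 (PDF p. 5) and §1.4.3 (PDF p. 7)] [cite: SilvermanAEC2009, Thm. X.4.14, VII.1 Remark 1.1 and VII.5 Prop. 5.1]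
[cite: PerrinRiou2003, Prop. 4.8 (p. 162)] [cite: IrelandRosen1990, Prop. 5.1.2 and §8.1] [cite: MazurTateTeitelbaum1986Invent, §I.8 (8.6)]
[cite: Miller2011LMS, Def. 1.1] -/
theorem X6RankZero.bsdp_of_kimLower_of_casselsTate_of_prop48_of_ainvs_primeLevel_of_LValueBall
    (hKimL : Kim2026.rankZero_le_padicValNat_sha_of_kuriharaNumber_ne_zero)
    (hCT : exists_casselsTate_pairing (K := ℚ))
    (h48 : PerrinRiou2003.prop48_padicValRat_bsd_rank_zero_le)
    (hGZK : rank_eq_analyticRank_of_analyticRank_le_one) (hmod : hasEntireLFunction_rat)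
    (a1 a2 a3 a4 a6 : ℤ) (hmin : (⟨a1, a2, a3, a4, a6⟩ : WeierstrassCurve ℚ).IsGloballyMinimal)
    -- the landed depth-`k` record and its rounding certificate
    {rs : List TwistRecordK} (hrs : CertifiedK rs) {r : TwistRecordK} (hr' : r ∈ rs) [Fact r.p.Prime]
    (hν : r.primes.length = 1) (hp5 : 5 ≤ r.p) (hk : 1 ≤ r.k)
    {cs : List RoundingCert} (hcs : RoundingCertifiedHasseK r.k cs) {c : RoundingCert} (hcc : c ∈ cs)
    (hcp : c.p = r.p) (hcn : c.n = r.n) (hcden : c.den = r.den) (hcbins : c.bins = r.bins) (hD' : 0 < c.dstar)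
    -- class X6 at `r.p`
    (hpΔ : ¬ (r.p : ℤ) ∣ discOf [a1, a2, a3, a4, a6]) {np : ℕ} (hcnt : countPoints [a1, a2, a3, a4, a6] r.p = np)
    (hap : (r.p : ℤ) ∣ (r.p : ℤ) + 1 - np) (hgcd : Int.gcd (discOf [a1, a2, a3, a4, a6]) (c4Of [a1, a2, a3, a4, a6]) = 1)
    -- the cyclic prime level `ℓ = r.n ∈ 𝒫_k`
    (ℓ : ℕ) [Fact ℓ.Prime] [NeZero r.n] (hrn : ℓ = r.n) (hℓp : ℓ ≠ r.p) (hℓ2 : ℓ ≠ 2)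
    (hℓΔ : ¬ (ℓ : ℤ) ∣ discOf [a1, a2, a3, a4, a6]) (h1 : ℓ ≡ 1 [MOD r.p ^ r.k]) {nl : ℕ}
    (hcl : countPoints [a1, a2, a3, a4, a6] ℓ = nl) (hd : r.p ^ r.k ∣ nl)
    (hcyc₁ : Nat.card {P : (((⟨a1, a2, a3, a4, a6⟩ : WeierstrassCurve ℤ)).map
        (Int.castRingHom (ZMod ℓ))).toAffine.Point // r.p • P = 0} ≤ r.p)
    {A : ℤ} (hA : A = (ℓ : ℤ) + 1 - nl - 2)
    -- data binders
    (hr0 : (⟨a1, a2, a3, a4, a6⟩ : WeierstrassCurve ℚ).analyticRank = 0)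
    (hkt : r.k ≤ padicValNat r.p (⟨a1, a2, a3, a4, a6⟩ : WeierstrassCurve ℚ).tamagawaProduct + 2)
    {q : ℚ} (hq : shaAn (⟨a1, a2, a3, a4, a6⟩ : WeierstrassCurve ℚ) = (q : ℂ)) {s : ℕ} (hv : padicValRat r.p q = 2 * s)
    {N : ℕ} [NeZero N] (D : ModularParametrizationData (⟨a1, a2, a3, a4, a6⟩ : WeierstrassCurve ℚ) N)
    (hc : ¬ (r.p : ℤ) ∣ D.maninConstant)
    (hper : ∃ u : ℚ, ‖(u : ℚ_[r.p])‖ = 1 ∧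
      (⟨a1, a2, a3, a4, a6⟩ : WeierstrassCurve ℚ).realPeriodRat = u * plusPeriod D.f)
    (ψ : (ℓ' : ℕ) → (ZMod ℓ')ˣ →* Multiplicative (ZMod (r.p ^ r.k))) (hψ : Function.Surjective (ψ ℓ))
    (hballL : ∀ (L : ZMod (r.p ^ r.k) → ℂ → ℂ), (∀ j, j ≠ 0 → Differentiable ℂ (L j)) →
      (∀ j, j ≠ 0 → ∀ s : ℂ, 2 < s.re → L j s = twistedLSeries D.f (binChar r.n ψ j)⁻¹ s) →
      ∀ k < r.p ^ r.k, ∃ mid rad : ℝ, rad ≤ (c.radNum : ℝ) / 10 ^ c.radExp ∧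
        |mid - ((c.binsStar.getD k 0 : ℤ) : ℝ)| ≤ (c.marNum : ℝ) / 10 ^ c.marExp ∧
        |(c.dstar : ℝ) * ((r.components : ℝ) *
          (((A : ℂ) * (⟨a1, a2, a3, a4, a6⟩ : WeierstrassCurve ℚ).entireLFunction 1 +
            ∑ j ∈ (Finset.univ : Finset (ZMod (r.p ^ r.k))).erase 0,
              ZMod.stdAddChar (-(j * (k : ZMod (r.p ^ r.k)))) *
                (gaussSum (binChar r.n ψ j) (ZMod.stdAddChar (N := r.n)) * L j 1)).re /
            ((r.p ^ r.k : ℕ) * plusPeriod D.f))) - mid| ≤ rad) :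
    BSDp (⟨a1, a2, a3, a4, a6⟩ : WeierstrassCurve ℚ) r.p := by
  have h0 : discOf [a1, a2, a3, a4, a6] ≠ 0 := fun h ↦ hpΔ (by rw [h]; exact dvd_zero _)
  haveI := isElliptic_of_discOf_ne_zero a1 a2 a3 a4 a6 h0
  haveI := hmin
  have hp2 : r.p ≠ 2 := by omega
  have hI : integralModelInt (⟨a1, a2, a3, a4, a6⟩ : WeierstrassCurve ℚ) = ⟨a1, a2, a3, a4, a6⟩ :=
    integralModelInt_eq_of_map_eq _ (map_mk_int a1 a2 a3 a4 a6)
  have hNl := natCard_point_eq_of_countPoints a1 a2 a3 a4 a6 ℓ hℓ2 hℓΔ hcl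
  have hX : ClassX6 (⟨a1, a2, a3, a4, a6⟩ : WeierstrassCurve ℚ) r.p :=
    classX6_of_intModel r.p hp5 hI (by rw [intCurve_Δ]; exact hpΔ)
      (natCard_point_eq_of_countPoints a1 a2 a3 a4 a6 r.p hp2 hpΔ hcnt) hap
      (by rw [intCurve_Δ, intCurve_c₄]; exact hgcd)
  have hK : Kato.IsKolyvaginPrime (⟨a1, a2, a3, a4, a6⟩ : WeierstrassCurve ℚ) r.p r.k ℓ :=
    Additive.isKolyvaginPrime_of_intModel_of_card hI r.p r.k ℓ hℓp (by rw [intCurve_Δ]; exact hℓΔ) h1 hNl hd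
  have hn : Kato.IsKolyvaginProduct (⟨a1, a2, a3, a4, a6⟩ : WeierstrassCurve ℚ) r.p r.k r.n := by
    rw [← hrn]; exact hK.isKolyvaginProduct
  have hν' : r.n.primeFactors.card = r.primes.length := by
    rw [← hrn, (Fact.out : ℓ.Prime).primeFactors, Finset.card_singleton, hν]
  have hcyc : ∀ (ℓ' : ℕ) [Fact ℓ'.Prime], ℓ' ∣ r.n →
      Nat.card {P : ((WeierstrassCurve.integralModelInt (⟨a1, a2, a3, a4, a6⟩ : WeierstrassCurve ℚ)).map
          (Int.castRingHom (ZMod ℓ'))).toAffine.Point // r.p • P = 0} ≤ r.p := by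
    rw [hI, ← hrn]
    exact forall_card_torsion_le_of_prime_level ⟨a1, a2, a3, a4, a6⟩ r.p ℓ hcyc₁
  have hψ' : ∀ ℓ' ∈ r.n.primeFactors, Function.Surjective (ψ ℓ') := by
    intro ℓ' h'
    rw [← hrn, (Fact.out : ℓ.Prime).primeFactors, Finset.mem_singleton] at h'
    subst h'; exact hψ
  have hprod : (∏ ℓ' ∈ r.n.primeFactors,
      (((⟨a1, a2, a3, a4, a6⟩ : WeierstrassCurve ℚ).frobeniusTrace ℓ' : ℂ) - 2)) = (A : ℂ) := by
    rw [← hrn]; exact prod_primeFactors_frobeniusTrace_sub_two_eq_of_prime hI Fact.out hNl hA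
  refine X6RankZero.bsdp_of_kimLower_of_casselsTate_of_prop48_of_certifiedK_of_LValueBall _ hKimL hCT h48 hGZK hmod hrs hr' hν'
    hp5 hX hr0 D hc hper hk hkt hn hcyc hcs hcc hcp hcn hcden hcbins hD' ψ hψ' ?_ hq hv
  intro L hL hL' k hk'
  obtain ⟨mid, rad, e1, e2, e3⟩ := hballL L hL hL' k hk'
  refine ⟨mid, rad, e1, e2, ?_⟩
  rw [hprod]
  exact e3

/-! ### §5 ERRATUM (same generation): the PRIME-LEVEL form §4 is VACUOUS in analytic rank `0` — PARITY

Two hours after §1–§4 landed, the two validation levels of the kit run j151573 (145146q1 @ 5, depth 3, the single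
Kolyvagin primes `ℓ = 54001` and `ℓ = 97001`) returned `δ̃_ℓ^{(3)} ≡ 0 (mod 125)` — and the reason is a THEOREM already
in the tree (cc-typer-4 GEN 6, `KuriharaLevelOnePrimePower.lean`, Kim 2022 Prop. 3.16 for `ν(n) = 1`): by the
functional equation of the Mazur–Tate element (Fricke symmetry `[a/ℓ]⁺ = w·[a'/ℓ]⁺`, `a' = −(Na)⁻¹`) and Hecke's
`Σ_a [a/ℓ]⁺ = (a_ℓ − 2)[0]⁺`, a curve with root number `w = +1` has `2·δ_ℓ(ψ) = (ψ(−1) − ψ(N))(a_ℓ − 2)\overline{[0]⁺}`,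
which is `0` modulo `p^k` at every Kolyvagin prime of depth `k` (`a_ℓ ≡ 2`).  Kim's Theorem 1.9 (5) carries this parity
clause ("for all `i ≥ ord(δ̃)` with `i ≡ ord(δ̃) (mod 2)`"): in analytic rank `0` only levels with an EVEN number of
prime factors can carry a non-zero Kurihara number.  So on X6 ∧ `r_an = 0` (where `L(E,1) ≠ 0` forces `w = +1`,
`rootNumber_eq_one_of_entireLFunction_one_ne_zero`) the hypothesis `hδ` of §2 at a prime level — and the
`hballL`-certified non-vanishing of §4 — can NEVER be met: §4 is a true but EMPTY shape.  What survives of this file: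
§1–§3 at levels with `ν(n)` even, i.e. a TWO-prime level `ℓ₁ℓ₂ ∈ 𝒩_{t+2}` whose Kurihara number vanishes modulo
`p^{t+1}` but not modulo `p^{t+2}` now ALSO closes a TAM-DEFECT cell (via Cassels–Tate), where gen 13's depth-`(t+1)`
shape needed non-vanishing modulo `p^{t+1}`; it does not make any of the four remaining cells cheaper (their
cheapest two-prime levels stay `≥ 2.7·10¹¹` series terms).  The theorems below put the vacuity in the kernel. -/

/-- **Every single-prime Kurihara number of a rank-`0` curve vanishes** (class-free): `L(E,1) ≠ 0`, `p` odd with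
`E[p]` irreducible (so the plus symbols are `p`-integral, `Additive.norm_ratPlusSymbol_le_one_of_irreducible`), `D`
a modular parametrisation datum at the CONDUCTOR level (`N = N_E`; at any other level this is Carayol's
`IsNewformOf.level_eq_conductorNorm`), `ℓ ∈ 𝒫_k` a Kolyvagin prime of depth `k`: `δ̃_ℓ^{(k)}(ψ) = 0` for EVERY `ψ`.
Proof: `w(E) = +1` (`frickeInvolution_eq_neg_of_entireLFunction_one_ne_zero`), then Kim's Prop. 3.16 for `ν = 1`
(the tree's `kuriharaNumber_prime_eq_zero_of_odd`). [cite: Kim2022StructureSelmer, Prop. 3.16 (PDF p. 19) and Thm. 1.9 (5) (PDF p. 8)]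
[cite: AtkinLehner1970, Thm. 3] [cite: MazurTate1987, §1] -/
theorem kuriharaNumber_primeLevel_eq_zero_of_entireLFunction_one_ne_zero
    (W : WeierstrassCurve ℚ) [W.IsElliptic] [W.IsGloballyMinimal] (p k : ℕ) [Fact p.Prime] (hp2 : p ≠ 2)
    (hirr : W.HasIrreducibleModPGaloisRep p) (hL : W.entireLFunction 1 ≠ 0)
    {N : ℕ} [NeZero N] (D : ModularParametrizationData W N) (hN : N = W.conductorNorm ℤ)
    {ℓ : ℕ} [Fact ℓ.Prime] (hK : Kato.IsKolyvaginPrime W p k ℓ)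
    (ψ : (q : ℕ) → (ZMod q)ˣ →* Multiplicative (ZMod (p ^ k))) :
    kuriharaNumber D.f (p ^ k) ℓ ψ = 0 := by
  subst hN
  have hf := D.isNewformOf
  have hW : IsFrickeEigen (W.conductorNorm ℤ) D.f (-(1 : ℂ)) :=
    isFrickeEigen_of_frickeInvolution_eq_smul _ (frickeInvolution_eq_neg_of_entireLFunction_one_ne_zero hf hL)
  have hℓN : ¬ ℓ ∣ W.conductorNorm ℤ := hK.not_dvd_conductorNorm
  have hgood : W.HasGoodReductionAtPrime ℓ := hasGoodReductionAtPrime_of_not_dvd_conductorNorm W hℓN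
  have h1 : ((ℓ : ℕ) : ZMod (p ^ k)) = 1 := by
    have := (ZMod.natCast_eq_natCast_iff (a := ℓ) (b := 1) (c := p ^ k)).mpr hK.modEq_one
    simpa using this
  have haℓ : ((W.frobeniusTrace ℓ : ℤ) : ZMod (p ^ k)) = 2 := by
    have h2 := (ZMod.intCast_eq_intCast_iff (a := W.frobeniusTrace ℓ) (b := (ℓ : ℤ) + 1) (c := p ^ k)).mpr
      hK.frobeniusTrace_modEq
    rw [h2]; push_cast; rw [h1]; norm_num
  have hint : ∀ a : ZMod ℓ, ‖(ratPlusSymbol D.f (((a.val : ℕ) : ℚ) / (ℓ : ℚ)) : ℚ_[p])‖ ≤ 1 := fun a =>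
    Additive.norm_ratPlusSymbol_le_one_of_irreducible hp2 hf hirr _
  exact kuriharaNumber_prime_eq_zero_of_odd (k := k) hf hW hp2 hgood hℓN haℓ hint ψ

/-- **On X6 ∧ `r_an = 0` (`p ≥ 5`) every single-prime Kurihara number vanishes** — the `hδ` of
`X6RankZero.bsdp_of_kimLower_of_casselsTate_of_prop48` at a prime level `n = ℓ`, and the certified non-vanishing
behind §4's `hballL`, are unsatisfiable (conductor level; any level modulo Carayol).  §4 is therefore EMPTY; the
four N4 TAM-DEFECT cells keep 'route exists (two-prime depth `t+1`, gen 13), certificate level out of reach'.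
[cite: Kim2022StructureSelmer, Prop. 3.16 (PDF p. 19) and Thm. 1.9 (5) (PDF p. 8)] [cite: Serre1972, §1.11 Prop. 12] -/
theorem X6RankZero.kuriharaNumber_primeLevel_eq_zero (W : WeierstrassCurve ℚ) [W.IsElliptic] [W.IsGloballyMinimal]
    (p k : ℕ) [Fact p.Prime] (hmod : hasEntireLFunction_rat) (hp5 : 5 ≤ p) (hX : ClassX6 W p)
    (hr : W.analyticRank = 0)
    {N : ℕ} [NeZero N] (D : ModularParametrizationData W N) (hN : N = W.conductorNorm ℤ)
    {ℓ : ℕ} [Fact ℓ.Prime] (hK : Kato.IsKolyvaginPrime W p k ℓ)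
    (ψ : (q : ℕ) → (ZMod q)ˣ →* Multiplicative (ZMod (p ^ k))) :
    kuriharaNumber D.f (p ^ k) ℓ ψ = 0 :=
  kuriharaNumber_primeLevel_eq_zero_of_entireLFunction_one_ne_zero W p k (by omega)
    (ClassX6.irr W p (by omega) hX) ((W.analyticRank_eq_zero_iff_holds (hmod W)).1 hr) D hN hK ψ

end Summit.BirchSwinnertonDyer.Rank1Residual.Supersingular

end
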